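import Literature.Barriers.FinalStateConjecture.KleinGordonModeConstruction
import HarnessLib

/-!
# The radial potential at the superradiant threshold `ω₀ = am/(2Mr₊)`: factorisation, normal
# form, and explicit tail estimates

Topic `Literature/Barriers/FinalStateConjecture`. Elementary real estimates on the potential
`V_μ` of the radial ODE (2.2) of Shlapentokh-Rothman, CMP 329 (2014), at the threshold frequency
`ω = ω₀ = am/(2Mr₊)` (his (4.1)/Theorem 1.5: real modes live exactly there), for REAL `λ` and `μ`,
feeding the shooting construction of the real mode (`HalfLineShooting.lean`, SR §4.2):

* `kgVre M a m lam μ r = Δ(λ̃ + μ²r²) − ω₀²(r² − r₊²)²`, `λ̃ = λ + a²ω₀² − 4Mr₊ω₀²`, and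
  `kgRadialPotential M a ω₀ m λ μ r = kgVre …` (`kgRadialPotential_omega0`): at threshold the
  potential vanishes at `r₊` and FACTORS through `(r − r₊)`;
* the normal-form coefficient `kgQsharp = (V − (M² − a²))/Δ²` of `v = √Δ R`, `v'' = q♯ v`
  (`kgQsharp`), its decomposition `q♯ − (μ² − ω₀²) = T₁ + T₂ + T₃ + T₄` (`kgQsharp_sub_eq`);
* explicit tail bounds: for `r ≥ 20(r₊ + M)`, `Δ ≥ (9/10) r²` and
  `q♯ ≥ (μ² − ω₀²) − (5Mω₀² + 2M²)/r` when `0 ≤ λ̃` (`kgQsharp_lower`), and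
  `q♯ ≤ (μ² − ω₀²) − (4/5)Mω₀²/r` when moreover `μ² ≤ (11/10)ω₀²`, `r ≥ 8λ̃/(Mω₀²)` (`kgQsharp_upper`) —
  the attractive Coulomb tail `−2M(2ω₀² − μ²)/r` responsible for the bound states near threshold.

Everything is proved (real algebra).

## References

* Y. Shlapentokh-Rothman, Comm. Math. Phys. 329 (2014) 859–891, §2 (2.2), §4.1–4.2, Thm. 1.5.
  Key `ShlapentokhRothman2014KleinGordon`.
-/

noncomputable section

open Set

namespace Literature.Barriers.FinalStateConjecture

open Literature.Geometry.Lorentzian Literature.Geometry.Lorentzian.Kerr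

/-! ### The threshold frequency and the factorised potential -/

/-- **The superradiant threshold frequency** `ω₀ = am/(2Mr₊)`. [cite: ShlapentokhRothman2014KleinGordon, Thm. 1.5] -/
def kgOmega0 (M a : ℝ) (m : ℤ) : ℝ := a * m / (2 * M * rPlus M a)

/-- The shifted separation constant `λ̃ = λ + a²ω₀² − 4Mr₊ω₀²` (`= λ + a²ω₀² − 2amω₀`). [folklore] -/
def kgLamTilde (M a : ℝ) (m : ℤ) (lam : ℝ) : ℝ := lam + a ^ 2 * kgOmega0 M a m ^ 2 - 4 * M * rPlus M a * kgOmega0 M a m ^ 2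

/-- **The real radial potential at threshold**: `V_μ(r) = Δ(λ̃ + μ²r²) − ω₀²(r² − r₊²)²`.
[cite: ShlapentokhRothman2014KleinGordon, §2 (2.2)] -/
def kgVre (M a : ℝ) (m : ℤ) (lam μ r : ℝ) : ℝ :=
  delta M a r * (kgLamTilde M a m lam + μ ^ 2 * r ^ 2) - kgOmega0 M a m ^ 2 * (r ^ 2 - rPlus M a ^ 2) ^ 2

variable {M a : ℝ} {m : ℤ}

/-- `am = 2Mr₊ω₀` (for `M r₊ ≠ 0`). [folklore] -/
theorem a_mul_m_eq (hM : M ≠ 0) (hr : rPlus M a ≠ 0) : a * m = 2 * M * rPlus M a * kgOmega0 M a m := by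
  unfold kgOmega0; field_simp

/-- **The complex potential (2.2) at `ω = ω₀` with real `λ, μ` is the real factorised potential.**
[cite: ShlapentokhRothman2014KleinGordon, §2 (2.2)] -/
theorem kgRadialPotential_omega0 (h : IsSubextremal M a) (lam μ r : ℝ) :
    kgRadialPotential M a (kgOmega0 M a m : ℂ) m (lam : ℂ) μ r = (kgVre M a m lam μ r : ℂ) := by
  have hM : M ≠ 0 := h.pos.ne'
  have hr : rPlus M a ≠ 0 := by
    have : 0 < rPlus M a := lt_of_le_of_lt h.rMinus_nonneg h.rMinus_lt_rPlus
    exact this.ne'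
  have ham := a_mul_m_eq (m := m) hM hr
  have hsq : rPlus M a ^ 2 + a ^ 2 = 2 * M * rPlus M a := by
    have h0 := delta_rPlus h.le
    unfold delta at h0
    linarith
  unfold kgRadialPotential kgVre kgLamTilde delta
  push_cast
  set w := kgOmega0 M a m
  set rp := rPlus M a
  -- `am = 2 M rp w`, `a² = 2 M rp − rp²`
  have ha2 : a ^ 2 = 2 * M * rp - rp ^ 2 := by linarith
  have ham' : (a : ℝ) * m = 2 * M * rp * w := ham
  -- work over `ℝ` then cast
  have key : -((r ^ 2 + a ^ 2) ^ 2) * w ^ 2 + 4 * M * a * m * r * w - a ^ 2 * (m : ℝ) ^ 2 +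
      (r ^ 2 - 2 * M * r + a ^ 2) * (lam + a ^ 2 * w ^ 2 + μ ^ 2 * r ^ 2) =
      (r ^ 2 - 2 * M * r + a ^ 2) * (lam + a ^ 2 * w ^ 2 - 4 * M * rp * w ^ 2 + μ ^ 2 * r ^ 2) -
        w ^ 2 * (r ^ 2 - rp ^ 2) ^ 2 := by
    have hm2 : a ^ 2 * (m : ℝ) ^ 2 = (2 * M * rp * w) ^ 2 := by rw [← ham']; ring
    rw [show 4 * M * a * (m : ℝ) * r * w = 4 * M * r * w * (a * m) by ring, ham', hm2, ha2]
    ring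
  have hc := congrArg (fun x : ℝ ↦ (x : ℂ)) key
  push_cast at hc ⊢
  linear_combination hc

/-- `V_μ(r₊) = 0` at threshold. [cite: ShlapentokhRothman2014KleinGordon, §4.1] -/
theorem kgVre_rPlus (h : IsSubextremal M a) (lam μ : ℝ) : kgVre M a m lam μ (rPlus M a) = 0 := by
  simp [kgVre, delta_rPlus h.le]

/-! ### The normal form `v = √Δ R`, `v'' = q♯ v` -/

/-- **The normal-form coefficient** `q♯ = (V − (M² − a²))/Δ²` (so that `v = √Δ R` satisfies
`v'' = q♯ v` when `Δ(ΔR')' = VR`; note `Δ − (r − M)² = a² − M²`). [folklore] -/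
def kgQsharp (M a : ℝ) (m : ℤ) (lam μ r : ℝ) : ℝ := (kgVre M a m lam μ r - (M ^ 2 - a ^ 2)) / delta M a r ^ 2

/-- **The decomposition of `q♯ − γ²`** (`γ² = μ² − ω₀²`) on `(r₊, ∞)`:
`q♯ − γ² = μ²(2Mr − a²)/Δ + λ̃/Δ − 2Mω₀²(r − r₊)(2r² − 2Mr + a² − r₊²)/Δ² − (M² − a²)/Δ²`. [folklore] -/
theorem kgQsharp_sub_eq (h : IsSubextremal M a) (lam μ : ℝ) {r : ℝ} (hr : rPlus M a < r) :
    kgQsharp M a m lam μ r - (μ ^ 2 - kgOmega0 M a m ^ 2) =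
      μ ^ 2 * (2 * M * r - a ^ 2) / delta M a r + kgLamTilde M a m lam / delta M a r -
        2 * M * kgOmega0 M a m ^ 2 * (r - rPlus M a) * (2 * r ^ 2 - 2 * M * r + a ^ 2 - rPlus M a ^ 2) / delta M a r ^ 2 -
        (M ^ 2 - a ^ 2) / delta M a r ^ 2 := by
  have hΔ : 0 < delta M a r := by
    rw [delta_eq_mul h.le]
    exact mul_pos (sub_pos.2 hr) (sub_pos.2 (h.rMinus_lt_rPlus.trans hr))
  have hsq : rPlus M a ^ 2 + a ^ 2 = 2 * M * rPlus M a := by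
    have h0 := delta_rPlus h.le
    unfold delta at h0
    linarith
  have hΔdef : delta M a r = r ^ 2 - 2 * M * r + a ^ 2 := rfl
  set P := r ^ 2 - 2 * M * r + a ^ 2 with hP
  rw [hΔdef] at hΔ
  have hPne : P ≠ 0 := hΔ.ne'
  have hP2 : P ^ 2 ≠ 0 := pow_ne_zero 2 hPne
  set w2 := kgOmega0 M a m ^ 2
  set L := kgLamTilde M a m lam
  -- the polynomial identity behind the decomposition (uses `r₊² + a² = 2Mr₊`)
  have key : kgVre M a m lam μ r - (M ^ 2 - a ^ 2) - P ^ 2 * (μ ^ 2 - w2) =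
      P * (μ ^ 2 * (2 * M * r - a ^ 2)) + P * L -
        2 * M * w2 * (r - rPlus M a) * (2 * r ^ 2 - 2 * M * r + a ^ 2 - rPlus M a ^ 2) - (M ^ 2 - a ^ 2) := by
    unfold kgVre
    rw [hΔdef]
    linear_combination (w2 * (2 * r ^ 2 - 2 * M * r + a ^ 2 - rPlus M a ^ 2)) * hsq
  unfold kgQsharp
  rw [hΔdef, div_sub' hP2, key]
  field_simp

/-! ### Tail estimates -/

/-- For `r ≥ 20(r₊ + M)` (`M > 0`, `r₊ ≥ 0`): `(9/10) r² ≤ Δ ≤ r²… ≤ r² + a²` and `r > r₊`. [folklore] -/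
theorem delta_ge_of_far (h : IsSubextremal M a) {r : ℝ} (hr : 20 * (rPlus M a + M) ≤ r) :
    9 / 10 * r ^ 2 ≤ delta M a r ∧ delta M a r ≤ r ^ 2 + a ^ 2 ∧ rPlus M a < r ∧ 0 < r := by
  have hM := h.pos
  have hrp : 0 ≤ rPlus M a := le_trans h.rMinus_nonneg h.rMinus_lt_rPlus.le
  have hr0 : 0 < r := by nlinarith
  unfold delta
  refine ⟨by nlinarith [sq_nonneg a], by nlinarith, by nlinarith, hr0⟩

/-- Far-field elementary facts for `r ≥ 20(r₊ + M)`: `a² ≤ r²/400`, `(81/100) r⁴ ≤ Δ²`,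
`Δ² ≤ (401/400)² r⁴`. [folklore] -/
theorem far_aux (h : IsSubextremal M a) {r : ℝ} (hr : 20 * (rPlus M a + M) ≤ r) :
    a ^ 2 ≤ 1 / 400 * r ^ 2 ∧ 81 / 100 * r ^ 4 ≤ delta M a r ^ 2 ∧ delta M a r ^ 2 ≤ (401 / 400) ^ 2 * r ^ 4 := by
  obtain ⟨hΔ1, hΔ2, hrp, hr0⟩ := delta_ge_of_far h hr
  have hM := h.pos
  have hrp0 : 0 ≤ rPlus M a := le_trans h.rMinus_nonneg h.rMinus_lt_rPlus.le
  have ha : a ^ 2 < M ^ 2 := by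
    have := h; unfold IsSubextremal at this
    nlinarith [abs_nonneg a, sq_abs a]
  have hMr : 400 * M ^ 2 ≤ r ^ 2 := by nlinarith
  have ha2 : a ^ 2 ≤ 1 / 400 * r ^ 2 := by nlinarith
  have hD0 : 0 ≤ delta M a r := by nlinarith
  refine ⟨ha2, ?_, ?_⟩
  · have := pow_le_pow_left₀ (by positivity : (0 : ℝ) ≤ 9 / 10 * r ^ 2) hΔ1 2
    nlinarith [this]
  · have hup : delta M a r ≤ 401 / 400 * r ^ 2 := by nlinarith
    have := pow_le_pow_left₀ hD0 hup 2
    nlinarith [this]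

set_option maxHeartbeats 400000 in
/-- **Lower tail bound**: for `0 ≤ λ̃`, `r ≥ 20(r₊ + M)`:
`q♯ ≥ (μ² − ω₀²) − 5Mω₀²/r − 2M²/r⁴`. [cite: ShlapentokhRothman2014KleinGordon, §4.2] -/
theorem kgQsharp_lower (h : IsSubextremal M a) {lam μ r : ℝ} (hlam : 0 ≤ kgLamTilde M a m lam)
    (hr : 20 * (rPlus M a + M) ≤ r) :
    (μ ^ 2 - kgOmega0 M a m ^ 2) - 5 * M * kgOmega0 M a m ^ 2 / r - 2 * M ^ 2 / r ^ 4 ≤ kgQsharp M a m lam μ r := by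
  obtain ⟨hΔ1, hΔ2, hrp, hr0⟩ := delta_ge_of_far h hr
  obtain ⟨ha2, hD2lo, hD2hi⟩ := far_aux h hr
  have hM := h.pos
  have hrp0 : 0 ≤ rPlus M a := le_trans h.rMinus_nonneg h.rMinus_lt_rPlus.le
  have hΔ0 : 0 < delta M a r := by nlinarith
  have ha : a ^ 2 < M ^ 2 := by
    have := h; unfold IsSubextremal at this
    nlinarith [abs_nonneg a, sq_abs a]
  have hdec := kgQsharp_sub_eq (m := m) h lam μ hrp
  set w2 := kgOmega0 M a m ^ 2 with hw2
  have hw2n : 0 ≤ w2 := sq_nonneg _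
  set D := delta M a r with hD
  set L := kgLamTilde M a m lam
  -- each term bounded
  have t1 : 0 ≤ μ ^ 2 * (2 * M * r - a ^ 2) / D := by
    apply div_nonneg _ hΔ0.le
    apply mul_nonneg (sq_nonneg _)
    nlinarith
  have t2 : 0 ≤ L / D := div_nonneg hlam hΔ0.le
  -- `T₃`: numerator ≤ 2 M w2 · (r · (2r² + a²))`, and `r²(2r² + a²) ≤ (5/2) D²`
  have n1 : (r - rPlus M a) * (2 * r ^ 2 - 2 * M * r + a ^ 2 - rPlus M a ^ 2) ≤ r * (2 * r ^ 2 + a ^ 2) := by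
    have f1 : r - rPlus M a ≤ r := by linarith
    have f2 : 2 * r ^ 2 - 2 * M * r + a ^ 2 - rPlus M a ^ 2 ≤ 2 * r ^ 2 + a ^ 2 := by nlinarith [sq_nonneg (rPlus M a)]
    have f3 : 0 ≤ 2 * r ^ 2 - 2 * M * r + a ^ 2 - rPlus M a ^ 2 := by nlinarith [sq_nonneg a]
    have f4 : 0 ≤ r - rPlus M a := by linarith
    calc (r - rPlus M a) * (2 * r ^ 2 - 2 * M * r + a ^ 2 - rPlus M a ^ 2)
        ≤ r * (2 * r ^ 2 - 2 * M * r + a ^ 2 - rPlus M a ^ 2) := mul_le_mul_of_nonneg_right f1 f3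
      _ ≤ r * (2 * r ^ 2 + a ^ 2) := mul_le_mul_of_nonneg_left f2 hr0.le
  have n2 : r * (r * (2 * r ^ 2 + a ^ 2)) ≤ 5 / 2 * D ^ 2 := by
    have : r * (r * (2 * r ^ 2 + a ^ 2)) ≤ 801 / 400 * r ^ 4 := by nlinarith
    nlinarith [hD2lo]
  have t3 : 2 * M * w2 * (r - rPlus M a) * (2 * r ^ 2 - 2 * M * r + a ^ 2 - rPlus M a ^ 2) / D ^ 2 ≤ 5 * M * w2 / r := by
    rw [div_le_div_iff₀ (by positivity) hr0]
    have hk : 0 ≤ 2 * M * w2 := by positivity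
    calc 2 * M * w2 * (r - rPlus M a) * (2 * r ^ 2 - 2 * M * r + a ^ 2 - rPlus M a ^ 2) * r
        = 2 * M * w2 * (r * ((r - rPlus M a) * (2 * r ^ 2 - 2 * M * r + a ^ 2 - rPlus M a ^ 2))) := by ring
      _ ≤ 2 * M * w2 * (r * (r * (2 * r ^ 2 + a ^ 2))) := by
          apply mul_le_mul_of_nonneg_left _ hk
          exact mul_le_mul_of_nonneg_left n1 hr0.le
      _ ≤ 2 * M * w2 * (5 / 2 * D ^ 2) := mul_le_mul_of_nonneg_left n2 hk
      _ = 5 * M * w2 * D ^ 2 := by ring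
  have t4 : (M ^ 2 - a ^ 2) / D ^ 2 ≤ 2 * M ^ 2 / r ^ 4 := by
    rw [div_le_div_iff₀ (by positivity) (by positivity)]
    have : (M ^ 2 - a ^ 2) * r ^ 4 ≤ M ^ 2 * r ^ 4 := by nlinarith [sq_nonneg a, pow_pos hr0 4]
    nlinarith [hD2lo, sq_nonneg M]
  nlinarith [hdec, t1, t2, t3, t4]

set_option maxHeartbeats 400000 in
/-- **Upper tail bound near threshold** (the attractive Coulomb tail `−2M(2ω₀² − μ²)/r`): for
`μ² ≤ (11/10) ω₀²`, `r ≥ 20(r₊ + M)` and `8λ̃ ≤ Mω₀² r`: `q♯ ≤ (μ² − ω₀²) − (4/5)Mω₀²/r`.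
[cite: ShlapentokhRothman2014KleinGordon, §4.2] -/
theorem kgQsharp_upper (h : IsSubextremal M a) {lam μ r : ℝ}
    (hw0 : kgOmega0 M a m ≠ 0) (hμ : μ ^ 2 ≤ 11 / 10 * kgOmega0 M a m ^ 2)
    (hr : 20 * (rPlus M a + M) ≤ r) (hrL : 8 * kgLamTilde M a m lam ≤ M * kgOmega0 M a m ^ 2 * r) :
    kgQsharp M a m lam μ r ≤ (μ ^ 2 - kgOmega0 M a m ^ 2) - 4 / 5 * (M * kgOmega0 M a m ^ 2) / r := by
  obtain ⟨hΔ1, hΔ2, hrp, hr0⟩ := delta_ge_of_far h hr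
  obtain ⟨ha2, hD2lo, hD2hi⟩ := far_aux h hr
  have hM := h.pos
  have hrp0 : 0 ≤ rPlus M a := le_trans h.rMinus_nonneg h.rMinus_lt_rPlus.le
  have hΔ0 : 0 < delta M a r := by nlinarith
  have ha : a ^ 2 < M ^ 2 := by
    have := h; unfold IsSubextremal at this
    nlinarith [abs_nonneg a, sq_abs a]
  have hdec := kgQsharp_sub_eq (m := m) h lam μ hrp
  set w2 := kgOmega0 M a m ^ 2 with hw2
  have hw2p : 0 < w2 := by positivity
  set D := delta M a r with hD
  set L := kgLamTilde M a m lam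
  have hMw : 0 < M * w2 := mul_pos hM hw2p
  have hX2 : 0 ≤ M * w2 * r ^ 2 := by positivity
  -- T₁ ≤ (49/20) M w2 / r
  have t1 : μ ^ 2 * (2 * M * r - a ^ 2) / D ≤ 49 / 20 * (M * w2) / r := by
    rw [div_le_div_iff₀ hΔ0 hr0]
    have f0 : 0 ≤ 2 * M * r - a ^ 2 := by nlinarith
    have f1 : μ ^ 2 * (2 * M * r - a ^ 2) ≤ 11 / 10 * w2 * (2 * M * r) := by
      calc μ ^ 2 * (2 * M * r - a ^ 2) ≤ 11 / 10 * w2 * (2 * M * r - a ^ 2) := mul_le_mul_of_nonneg_right hμ f0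
        _ ≤ 11 / 10 * w2 * (2 * M * r) := by
            apply mul_le_mul_of_nonneg_left _ (by positivity); nlinarith [sq_nonneg a]
    calc μ ^ 2 * (2 * M * r - a ^ 2) * r ≤ 11 / 10 * w2 * (2 * M * r) * r := mul_le_mul_of_nonneg_right f1 hr0.le
      _ = 11 / 5 * (M * w2 * r ^ 2) := by ring
      _ ≤ 49 / 20 * (M * w2) * (9 / 10 * r ^ 2) := by
          have : 49 / 20 * (M * w2) * (9 / 10 * r ^ 2) = 441 / 200 * (M * w2 * r ^ 2) := by ring
          linarith [hX2]
      _ ≤ 49 / 20 * (M * w2) * D := mul_le_mul_of_nonneg_left hΔ1 (by positivity)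
  -- T₂ ≤ (5/36) M w2 / r
  have t2 : L / D ≤ 5 / 36 * (M * w2) / r := by
    rw [div_le_div_iff₀ hΔ0 hr0]
    calc L * r ≤ 1 / 8 * (M * w2 * r) * r := by
          apply mul_le_mul_of_nonneg_right _ hr0.le; linarith
      _ = 5 / 36 * (M * w2) * (9 / 10 * r ^ 2) := by ring
      _ ≤ 5 / 36 * (M * w2) * D := mul_le_mul_of_nonneg_left hΔ1 (by positivity)
  -- T₃ ≤ −(17/5) M w2 / r
  have n1 : 19 / 20 * r ≤ r - rPlus M a := by linarith
  have n2 : 189 / 100 * r ^ 2 ≤ 2 * r ^ 2 - 2 * M * r + a ^ 2 - rPlus M a ^ 2 := by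
    have hrp20 : 20 * rPlus M a ≤ r := by linarith
    have hM20 : 20 * M ≤ r := by linarith
    have e1 : rPlus M a ^ 2 ≤ 1 / 400 * r ^ 2 := by
      have := mul_le_mul hrp20 hrp20 (by positivity) hr0.le
      nlinarith [this]
    have e2 : 2 * M * r ≤ 1 / 10 * r ^ 2 := by
      have := mul_le_mul_of_nonneg_right hM20 hr0.le
      nlinarith [this]
    nlinarith [sq_nonneg a, e1, e2]
  have n3 : 19 / 20 * r * (189 / 100 * r ^ 2) ≤ (r - rPlus M a) * (2 * r ^ 2 - 2 * M * r + a ^ 2 - rPlus M a ^ 2) :=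
    mul_le_mul n1 n2 (by positivity) (by linarith)
  have t3 : 17 / 5 * (M * w2) / r ≤
      2 * M * w2 * (r - rPlus M a) * (2 * r ^ 2 - 2 * M * r + a ^ 2 - rPlus M a ^ 2) / D ^ 2 := by
    rw [div_le_div_iff₀ hr0 (by positivity)]
    have hk : 0 ≤ 2 * M * w2 * r := by positivity
    have lhs : 17 / 5 * (M * w2) * D ^ 2 ≤ 17 / 5 * (M * w2) * ((401 / 400) ^ 2 * r ^ 4) :=
      mul_le_mul_of_nonneg_left hD2hi (by positivity)
    have rhs : 2 * M * w2 * r * (19 / 20 * r * (189 / 100 * r ^ 2)) ≤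
        2 * M * w2 * (r - rPlus M a) * (2 * r ^ 2 - 2 * M * r + a ^ 2 - rPlus M a ^ 2) * r := by
      calc 2 * M * w2 * r * (19 / 20 * r * (189 / 100 * r ^ 2))
          ≤ 2 * M * w2 * r * ((r - rPlus M a) * (2 * r ^ 2 - 2 * M * r + a ^ 2 - rPlus M a ^ 2)) :=
            mul_le_mul_of_nonneg_left n3 hk
        _ = _ := by ring
    have mid : 17 / 5 * (M * w2) * ((401 / 400) ^ 2 * r ^ 4) ≤ 2 * M * w2 * r * (19 / 20 * r * (189 / 100 * r ^ 2)) := by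
      have hX4 : 0 ≤ M * w2 * r ^ 4 := by positivity
      have hc : (0 : ℝ) ≤ 2 * (19 / 20) * (189 / 100) - 17 / 5 * (401 / 400) ^ 2 := by norm_num
      have hring : 2 * M * w2 * r * (19 / 20 * r * (189 / 100 * r ^ 2)) - 17 / 5 * (M * w2) * ((401 / 400) ^ 2 * r ^ 4) =
          (2 * (19 / 20) * (189 / 100) - 17 / 5 * (401 / 400) ^ 2) * (M * w2 * r ^ 4) := by ring
      linarith [mul_nonneg hc hX4, hring]
    linarith
  have t4 : 0 ≤ (M ^ 2 - a ^ 2) / D ^ 2 := div_nonneg (by linarith) (by positivity)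
  rw [show 4 / 5 * (M * kgOmega0 M a m ^ 2) / r = 4 / 5 * ((M * w2) / r) by rw [hw2]; ring]
  have hq : 0 ≤ (M * w2) / r := by positivity
  have e1 : 49 / 20 * (M * w2) / r = 49 / 20 * ((M * w2) / r) := by ring
  have e2 : 5 / 36 * (M * w2) / r = 5 / 36 * ((M * w2) / r) := by ring
  have e3 : 17 / 5 * (M * w2) / r = 17 / 5 * ((M * w2) / r) := by ring
  rw [e1] at t1; rw [e2] at t2; rw [e3] at t3
  linarith [hdec, t1, t2, t3, t4, hq]

end Literature.Barriers.FinalStateConjecture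

end
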